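import Mathlib
import HarnessLib
import Literature.AlgebraicGeometry.Resolution.BlowupRingExceptionalFibre
import Literature.AlgebraicGeometry.Resolution.QuadraticTransformsStructure
import Literature.AlgebraicGeometry.Resolution.BlowupDimension
import Summits.ResolutionOfSingularities.ResolutionOfSingularities.Theorems.WildQuotientsWildQuotientResolutionKSGoingDownQuadraticTransformRegular
import Summits.ResolutionOfSingularities.ResolutionOfSingularities.Theorems.WildQuotientsWildQuotientResolutionKSGoingDownLocalGlue
import Summits.ResolutionOfSingularities.ResolutionOfSingularities.Theorems.WildQuotientsWildQuotientResolutionKSBlowupValuationPoint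
import Summits.ResolutionOfSingularities.ResolutionOfSingularities.Theorems.WildQuotientsWildQuotientResolutionKSBlowupFixedPoint
import Summits.ResolutionOfSingularities.ResolutionOfSingularities.Theorems.WildQuotientsWildQuotientResolutionKSBlowupFixedPointStalk

/-!
# Kollár–Szabó going down, blow-up step (K2-scheme, conclusion): the fixed point of the point blow-up is a
# REGULAR point with algebraically closed residue field (crux `WildQuotients.WildQuotientResolution`,
# stub `stub_phaseZeroHighDim`)

Crux stmt-ResolutionOfSingularities-15640 (`WildQuotientResolution`), registered stub `stub_phaseZeroHighDim`;
programme PHASE0-KS-EIGENLINE. Assembly of hand 8-g2's chain ✓`KSBlowupFixedPoint` (p828806: the `H`-fixed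
point `x'` of `Bl_x X` with inertia, and its quadratic-transform chart `φ : Spec R → X'`) with
✓`KSBlowupFixedPointStalk` (p829061: `𝒪_{X',x'} ≅ R`) and the algebra of quadratic transforms:

* `isRegularLocalRing_of_isQuadraticTransform` — **a quadratic transform `R` of a REGULAR local subring
  `S ⊆ K` is a regular local ring**: its chart element `x` lies in `𝔪_S ∖ 𝔪_S²` (else `x` would be a unit of
  `R`, hence of `S` by domination), so extends to a regular system of parameters (✓`exists_rsop_apply_eq`),
  `S[𝔪/x]` is a regular ring (✓`isRegularRing_blowupRing`), and `R = S[𝔪/x]_𝔫` (✓`IsQuadraticTransform.eq_ofPrime`,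
  ✓`KSGoingDown.isRegularLocalRing_ofPrime`);
* `exists_regular_fixedPoint_liftAction` — **for an integral locally Noetherian `X`, an abelian `G = I_x` at a
  closed point `x` with `𝒪_{X,x}` regular, not a field, residue field algebraically closed, and a blowing up
  `π : X' → X` of the reduced point `{x}` with its LIFTED action: there is `x' ∈ X'` over `x`, in the inertia of
  every `g`, with `𝒪_{X',x'}` REGULAR, residue field ALGEBRAICALLY CLOSED (same as `κ(x)`), and
  `dim 𝒪_{X',x'} ≤ dim 𝒪_{X,x}`** — so the hypotheses reproduce and the Kollár–Szabó fixed point climbs any tower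
  of point blow-ups (Reichstein–Youssin 2000, App., proof of Prop. A.2).

[OURS · crux stmt-ResolutionOfSingularities-15640 · helper toward `stub_phaseZeroHighDim` (conclusion of the
(K2-scheme) chain; NOT a proof of the stub); counted 0; AI-level work, weaker than expert review.]
[cite: ReichsteinYoussin2000, Appendix (Kollár–Szabó), proof of Prop. A.2]
-/

-- single-problem summit: the doubled namespace component `ResolutionOfSingularities` is forced
set_option linter.dupNamespace false

noncomputable section

open CategoryTheory CategoryTheory.Limits AlgebraicGeometry TopologicalSpace IsLocalRing
open Literature.AlgebraicGeometry.Ramification Literature.AlgebraicGeometry.Resolution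
open Scheme.IdealSheafData
open Summit.ResolutionOfSingularities.ResolutionOfSingularities.Theorems.WildQuotientResolution

namespace Summit.ResolutionOfSingularities.ResolutionOfSingularities.Theorems.WildQuotientResolution.KSGoingDown

universe u

/-! ## Quadratic transforms of regular local rings are regular -/

section Algebra

variable {K : Type u} [Field K]

/-- The chart element of a quadratic transform is NOT in `𝔪_S²`: otherwise `𝔪_S R = x R ⊆ (𝔪_S R)² = x² R`
makes `x` a unit of `R`, hence of `S` (domination). [folklore] -/
theorem chart_not_mem_sq_of_isQuadraticTransform {S R : Subring K} [IsLocalRing S] [IsLocalRing R]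
    {x : S} (hx : x ∈ maximalIdeal S) (hx0 : x ≠ 0) (hBle : blowupRing S (x : K) ≤ R)
    (hdom : SubringDominates S R) : x ∉ maximalIdeal S ^ 2 := by
  have hx0K : ((x : S) : K) ≠ 0 := fun h => hx0 (Subtype.ext h)
  have hSR : S ≤ R := (le_blowupRing S (x : K)).trans hBle
  -- every `m ∈ 𝔪_S` is `r · x` with `r ∈ R`
  have hmR : ∀ m ∈ maximalIdeal S, ∃ r : R, ((m : S) : K) = (r : K) * x := fun m hm =>
    ⟨⟨_, hBle (div_mem_blowupRing _ hm)⟩, by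
      change ((m : S) : K) = ((m : S) : K) / x * x
      rw [div_mul_cancel₀ _ hx0K]⟩
  intro hx2
  -- `x ∈ 𝔪² = 𝔪 * 𝔪` is `r · x · x`
  have key : ∀ y ∈ maximalIdeal S * maximalIdeal S, ∃ r : R, ((y : S) : K) = (r : K) * x * x := by
    intro y hy
    refine Submodule.mul_induction_on hy ?_ ?_
    · intro a ha b hb
      obtain ⟨r₁, h₁⟩ := hmR a ha
      obtain ⟨r₂, h₂⟩ := hmR b hb
      exact ⟨r₁ * r₂, by rw [Subring.coe_mul, h₁, h₂, Subring.coe_mul]; ring⟩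
    · intro a b ha hb
      obtain ⟨r₁, h₁⟩ := ha
      obtain ⟨r₂, h₂⟩ := hb
      exact ⟨r₁ + r₂, by rw [Subring.coe_add, h₁, h₂, Subring.coe_add]; ring⟩
  rw [pow_two] at hx2
  obtain ⟨r, hr⟩ := key x hx2
  have hrx : (r : K) * x = 1 := by
    have h1 : (1 : K) * ((x : S) : K) = ((r : K) * x) * x := by rw [one_mul]; exact hr
    exact (mul_right_cancel₀ hx0K h1).symm
  have hinvR : (((x : S) : K))⁻¹ ∈ R := by
    rw [← (eq_inv_of_mul_eq_one_left hrx)]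
    exact r.2
  have hinvS : (((x : S) : K))⁻¹ ∈ S := hdom.2 _ x.2 hinvR
  have hu : IsUnit x := (isUnit_subring_iff_inv_mem x).mpr ⟨hx0K, hinvS⟩
  exact (IsLocalRing.mem_maximalIdeal _).mp hx hu

/-- **A quadratic transform of a regular local subring is a regular local ring**: `R = S[𝔪/x]_𝔫` with
`x ∈ 𝔪_S ∖ 𝔪_S²` a member of a regular system of parameters, `S[𝔪/x]` a regular ring
(✓`isRegularRing_blowupRing`), and localisations of regular rings are regular (✓`isRegularLocalRing_ofPrime`).
[cite: Cutkosky2014, §2.1] -/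
theorem isRegularLocalRing_of_isQuadraticTransform (S R : Subring K) [IsRegularLocalRing S] [IsLocalRing R]
    (hQT : IsQuadraticTransform S R) : IsRegularLocalRing R := by
  classical
  obtain ⟨_, x, hx, hx0, _, hBle, -, hdom⟩ := id hQT
  have hx2 : x ∉ maximalIdeal S ^ 2 := chart_not_mem_sq_of_isQuadraticTransform hx hx0 hBle hdom
  -- `x` is a member of a regular system of parameters
  have hd0 : 0 < (maximalIdeal S).spanFinrank := by
    rw [Nat.pos_iff_ne_zero, Ne, Submodule.spanFinrank_eq_zero_iff_eq_bot (IsNoetherian.noetherian _)]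
    intro hbot
    exact hx0 ((Submodule.mem_bot S).mp (hbot ▸ hx))
  obtain ⟨z, hz, hzi⟩ := exists_rsop_apply_eq (R := S) rfl hx hx2 ⟨0, hd0⟩
  haveI : IsRegularRing (blowupRing S ((x : S) : K)) := by
    have h := isRegularRing_blowupRing S rfl z hz ⟨0, hd0⟩
    rwa [hzi] at h
  rw [hQT.eq_ofPrime hx hx0 hBle]
  exact isRegularLocalRing_ofPrime _ _

end Algebra

/-! ## The regular fixed point -/

/-- **The Kollár–Szabó fixed point of the point blow-up is a regular point with algebraically closed residue
field.** For an integral locally Noetherian scheme `X`, an abelian group `G` with `g ∈ I_x` for all `g` at a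
closed point `x` whose local ring is regular, not a field, with algebraically closed residue field, and a blowing
up `π : X' → X` along the reduced closed point `{x}` with its lifted action: there is `x' ∈ X'` over `x` lying in
the inertia group of every `g`, with `𝒪_{X',x'}` regular, `κ(x')` algebraically closed and
`dim 𝒪_{X',x'} ≤ dim 𝒪_{X,x}`. [cite: ReichsteinYoussin2000, Appendix (Kollár–Szabó), proof of Prop. A.2] -/
theorem exists_regular_fixedPoint_liftAction {X : Scheme.{0}} [IsIntegral X] [IsLocallyNoetherian X]
    {G : Type} [CommGroup G] (σ : G →* Aut X) {x : X} (hx : IsClosed ({x} : Set X))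
    (hGx : ∀ g, g ∈ inertiaSubgroup σ x)
    [IsRegularLocalRing (X.presheaf.stalk x)] [IsAlgClosed (ResidueField (X.presheaf.stalk x))]
    (hnf : ¬ IsField (X.presheaf.stalk x))
    {X' : Scheme.{0}} {π : X' ⟶ X} (hπ : IsBlowup π (vanishingIdeal ⟨{x}, hx⟩)) :
    ∃ x' : X', π x' = x ∧
      (∀ g, g ∈ inertiaSubgroup (hπ.liftAction σ (vanishingIdeal_comap_eq_of_action σ ⟨{x}, hx⟩
        (preimage_singleton_eq_of_forall_mem_inertiaSubgroup σ hGx))) x') ∧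
      IsRegularLocalRing (X'.presheaf.stalk x') ∧ IsAlgClosed (ResidueField (X'.presheaf.stalk x')) ∧
      ringKrullDim (X'.presheaf.stalk x') ≤ ringKrullDim (X.presheaf.stalk x) := by
  haveI : IsIntegral X' :=
    hπ.isIntegral (vanishingIdeal_singleton_ne_bot hx (genericPoint_ne_of_not_isField hnf))
  obtain ⟨R, hRloc, ι, hιloc, t, φ, x', hQT, hι, -, -, -, hcong, hφ, hφx', hx'x, hinert⟩ :=
    exists_fixedPoint_liftAction σ hx hGx hnf hπ
  haveI := hRloc
  haveI := hιloc
  -- the model `S` of `𝒪_{X,x}` in its fraction field is a regular local ring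
  let O := X.presheaf.stalk x
  let f : O →+* FractionRing O := algebraMap O (FractionRing O)
  have hf : Function.Injective f := IsFractionRing.injective O (FractionRing O)
  have hrr : Function.Injective f.rangeRestrict := fun a b h => hf (congrArg Subtype.val h)
  let e : O ≃+* f.range := RingEquiv.ofBijective f.rangeRestrict ⟨hrr, RingHom.rangeRestrict_surjective f⟩
  haveI : IsRegularLocalRing f.range := IsRegularLocalRing.of_ringEquiv e
  -- hence so is `R`, and `𝒪_{X',x'} ≅ R`
  haveI : IsRegularLocalRing R := isRegularLocalRing_of_isQuadraticTransform _ R hQT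
  obtain ⟨eR⟩ := nonempty_stalk_ringEquiv_of_isQuadraticTransform hx hπ R hQT ι hι φ hφ hφx'
  -- the residue field of `R` is that of `𝒪_{X,x}`
  have hsurj : ∀ z : R, ∃ s : O, z - ι s ∈ maximalIdeal R := fun z => by
    obtain ⟨a, ha⟩ := hcong z
    exact ⟨a, by rw [← neg_sub]; exact neg_mem ha⟩
  haveI : IsAlgClosed (ResidueField R) := isAlgClosed_residueField_of_residue_surjective ι hsurj
  refine ⟨x', hx'x, hinert, IsRegularLocalRing.of_ringEquiv eR.symm,
    IsAlgClosed.of_ringEquiv (ResidueField R) _ (ResidueField.mapEquiv eR.symm), ?_⟩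
  have h := hπ.ringKrullDim_stalk_le x'
  rwa [hx'x] at h

end Summit.ResolutionOfSingularities.ResolutionOfSingularities.Theorems.WildQuotientResolution.KSGoingDown

end
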